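import Mathlib
import HarnessLib
import Summits.Langlands.Statement
import Summits.Langlands.Langlands.Theses.WachComponentCensus
import Literature.NumberTheory.GaloisRepresentations.PstCrystallineExtensionData
import Literature.NumberTheory.EllipticCurves.NewformGaloisRepDeligneOfThm61Proofs

/-!
# Route `WachComponentCensus` — the reducible sector of `PD2Unram` (item `stmt-Langlands-14643`)

Support lemmas for the (informal, not yet typed) support item `PD2Unram` of route
`Langlands/WachComponentCensus` ("every crystalline `ρ : Γ_K → GL₂(ℚ̄_p)`, `K/ℚ_p` unramified,
with regular labelled Hodge–Tate weights, is potentially diagonalizable", Barnet-Lamb–Gee–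
Geraghty–Taylor §1.4).  The route derives `PD2Unram` from its crux `TrivialFieldReachabilityR`
(the NON-ordinary points) plus the printed Lemma 1.4.3 (1) of BLGGT (the points with an invariant
complete flag).  This file settles, over the summit's own pinned `p`-adic Hodge datum
`RD.pst p v hv` (`Summit.Langlands.ReciprocityData.pst`) and EVERY compatible crystalline
extension datum `𝔈 : PstCrystallineExtensionData (RD.pst p v hv)`, the whole REDUCIBLE sector of
the typed statement, in every weight and for every `p` and every place `v ∣ p` (no hypothesis on
ramification is needed for this sector):

* `hasInvariantCompleteFlag_of_not_isIrreducible` — a rank-`2` framed representation over a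
  field which is NOT irreducible (Mathlib `Representation.IsIrreducible`) stabilises a complete
  flag (`FramedRep.HasInvariantCompleteFlag`: it is upper triangular after a change of frame) —
  the `n = 2` bookkeeping "reducible = has a stable line = has a complete flag";
* `isPotentiallyDiagonalizable_of_not_isIrreducible` — every `RD.pst`-crystalline, NOT
  irreducible `ρ : Γ_{F_v} → GL₂(ℚ̄_p)` is potentially diagonalizable relative to `𝔈.𝔅`
  (BLGGT Lemma 1.4.3 (1), the tree's proved `blggt2014_lemma_1_4_3_1_holds`, through
  `PstCrystallineExtensionData.isPotentiallyDiagonalizable_of_hasInvariantCompleteFlag`), given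
  that `F_v` is finite-dimensional over `ℚ_p` for the datum's algebra structure;
* `isPotentiallyDiagonalizable_of_not_isIrreducible_of_fontaineDatumExists` — the same with that
  finiteness discharged from the named fact `FontaineDatumExists` (the pinned datum then carries
  the canonical `ℚ_p`-structure of `F_v`, `fontainePstAdicCompletion_algebra`, for which
  `F_v/ℚ_p` is finite, `finiteDimensional_padic_adicCompletion`).

Hence a typed `PD2Unram` reduces to its IRREDUCIBLE sector (where the informal crux
`TrivialFieldReachabilityR` lives).  No statement of the route file is altered.
Axioms: `propext`, `Classical.choice`, `Quot.sound`.
-/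

set_option linter.dupNamespace false -- project-wide option; `Summit.Langlands.Langlands` is the mandated namespace

namespace Summit.Langlands.Langlands.Theorems

open IsDedekindDomain NumberField
open Literature.NumberTheory.GaloisRepresentations
open scoped Matrix

universe u v

/-- Over a field, every non-zero vector of `A²` is the first column of an invertible matrix.
[folklore] -/
theorem exists_gl_two_col_zero_eq {A : Type v} [Field A] (w : Fin 2 → A) (hw : w ≠ 0) :
    ∃ Q : GL (Fin 2) A, (Q : Matrix (Fin 2) (Fin 2) A).col 0 = w := by
  by_cases h0 : w 0 = 0
  · have h1 : w 1 ≠ 0 := by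
      intro h1
      apply hw
      funext i
      fin_cases i
      · exact h0
      · exact h1
    refine ⟨Matrix.GeneralLinearGroup.mkOfDetNeZero !![w 0, 1; w 1, 0] ?_, ?_⟩
    · simp [Matrix.det_fin_two, h0, h1]
    · funext i
      fin_cases i <;> simp
  · refine ⟨Matrix.GeneralLinearGroup.mkOfDetNeZero !![w 0, 0; w 1, 1] ?_, ?_⟩
    · simp [Matrix.det_fin_two, h0]
    · funext i
      fin_cases i <;> simp

/-- **Reducible rank-`2` representations have an invariant complete flag.**  If a framed
representation `ρ : G →ₜ* GL₂(A)` over a field `A` is not irreducible (Mathlib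
`Representation.IsIrreducible`: the lattice of subrepresentations of `A²` is not simple), then
`ρ(G)` stabilises a line `L = A·w`, and in any frame whose first vector is `w` every `ρ(g)` is
upper triangular, i.e. `ρ` has a `G`-invariant complete flag `0 ⊂ L ⊂ A²`
(`FramedRep.HasInvariantCompleteFlag`).  This is the case `n = 2` of "a reducible
representation with irreducible sub and quotient is block upper triangular"; for `n = 2` both
blocks are characters. [folklore] -/
theorem hasInvariantCompleteFlag_of_not_isIrreducible {G : Type u} [Group G] [TopologicalSpace G]
    {A : Type v} [Field A] [TopologicalSpace A] [IsTopologicalRing A] (ρ : FramedRep G A 2)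
    (h : ¬ ρ.IsIrreducible) : ρ.HasInvariantCompleteFlag := by
  classical
  -- `⊥ ≠ ⊤` among the subrepresentations of `A²`
  have hbt : (⊥ : Subrepresentation ρ.toRepresentation) ≠ ⊤ := by
    intro hbt
    have hmem : (Pi.single 0 1 : Fin 2 → A) ∈ (⊤ : Subrepresentation ρ.toRepresentation) :=
      Submodule.mem_top
    rw [← hbt] at hmem
    have h0 : (Pi.single 0 1 : Fin 2 → A) = 0 := (Submodule.mem_bot A).mp hmem
    have := congr_fun h0 0
    simp at this
  haveI : Nontrivial (Subrepresentation ρ.toRepresentation) := ⟨⟨⊥, ⊤, hbt⟩⟩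
  -- a proper non-zero subrepresentation `W`
  obtain ⟨W, hW0, hW1⟩ : ∃ W : Subrepresentation ρ.toRepresentation, W ≠ ⊥ ∧ W ≠ ⊤ := by
    by_contra hcon
    push Not at hcon
    exact h { eq_bot_or_eq_top := fun W => or_iff_not_imp_left.mpr (hcon W) }
  -- its underlying subspace `V` is a line `A·w`
  set V : Submodule A (Fin 2 → A) := W.toSubmodule with hVdef
  have hV0 : V ≠ ⊥ := fun hV => hW0 (Subrepresentation.toSubmodule_injective hV)
  have hV1 : V ≠ ⊤ := fun hV => hW1 (Subrepresentation.toSubmodule_injective hV)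
  obtain ⟨w, hwV, hw0⟩ := Submodule.exists_mem_ne_zero_of_ne_bot hV0
  have hVlt : Module.finrank A V < 2 := by
    have := Submodule.finrank_lt hV1
    simpa using this
  have hspan : Submodule.span A {w} = V := by
    refine Submodule.eq_of_le_of_finrank_le ((Submodule.span_singleton_le_iff_mem w V).mpr hwV) ?_
    rw [finrank_span_singleton hw0]
    omega
  -- `ρ(g) w = c • w`
  have hline : ∀ g : G, ∃ c : A,
      c • w = ((ρ g : GL (Fin 2) A) : Matrix (Fin 2) (Fin 2) A) *ᵥ w := by
    intro g
    have hmem : ρ.toRepresentation g w ∈ V := W.apply_mem_toSubmodule g hwV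
    rw [← hspan, Submodule.mem_span_singleton] at hmem
    simpa using hmem
  -- change of frame: `Q e₀ = w`, `P = Q⁻¹`
  obtain ⟨Q, hQ⟩ := exists_gl_two_col_zero_eq w hw0
  refine ⟨Q⁻¹, fun g i j hij => ?_⟩
  obtain ⟨c, hc⟩ := hline g
  have hQe : (Q : Matrix (Fin 2) (Fin 2) A) *ᵥ Pi.single 0 1 = w := by
    rw [Matrix.mulVec_single_one, hQ]
  have hPQ : ((Q⁻¹ : GL (Fin 2) A) : Matrix (Fin 2) (Fin 2) A) *ᵥ w = Pi.single 0 1 := by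
    rw [← hQe, Matrix.mulVec_mulVec, Matrix.coe_units_inv, Matrix.nonsing_inv_mul _
      (Matrix.isUnits_det_units Q), Matrix.one_mulVec]
  have key : (FramedRep.conj Q⁻¹ ρ).matrixFn g *ᵥ Pi.single 0 1 = c • Pi.single 0 1 := by
    simp only [FramedRep.matrixFn_apply, FramedRep.conj_apply, inv_inv, Units.val_mul]
    rw [← Matrix.mulVec_mulVec, ← Matrix.mulVec_mulVec, hQe, ← hc, Matrix.mulVec_smul, hPQ]
  have hcol : ∀ i : Fin 2, (FramedRep.conj Q⁻¹ ρ).matrixFn g i 0 = (c • Pi.single 0 1 : Fin 2 → A) i := by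
    intro i
    rw [← key, Matrix.mulVec_single_one, Matrix.col_apply]
  have hlt : (j : ℕ) < (i : ℕ) := Fin.lt_def.mp hij
  have hi2 := i.isLt
  have hi : i = 1 := Fin.ext (by simp only [Fin.val_one]; omega)
  have hj : j = 0 := Fin.ext (by simp only [Fin.val_zero]; omega)
  subst hi
  subst hj
  rw [hcol 1]
  simp

/-- **The reducible sector of `PD2Unram` over the summit's datum.**  For a number field `F`, a
prime `p`, a place `v ∣ p`, the pinned `p`-adic Hodge datum `RD.pst p v hv` of `F_v` and ANY
compatible crystalline extension datum `𝔈`, every `RD.pst`-crystalline `ρ : Γ_{F_v} → GL₂(ℚ̄_p)`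
which is NOT irreducible is potentially diagonalizable relative to `𝔈.𝔅` — in every weight,
with no hypothesis on `p` or on the ramification of `F_v` — provided `F_v` is finite over `ℚ_p`
for the datum's algebra structure (`hK`; discharged from `FontaineDatumExists` below).  BLGGT
Lemma 1.4.3 (1) (`blggt2014_lemma_1_4_3_1_holds`) applied to the invariant complete flag of
`hasInvariantCompleteFlag_of_not_isIrreducible`. [cite: BarnetlambEtAl2014, §1.4 Lemma 1.4.3 (1)] -/
theorem isPotentiallyDiagonalizable_of_not_isIrreducible
    (F : Type) [Field F] [NumberField F] (p : ℕ) [Fact p.Prime] (RD : ReciprocityData F)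
    (v : HeightOneSpectrum (𝓞 F)) (hv : ((p : ℕ) : 𝓞 F) ∈ v.asIdeal)
    (𝔈 : PstCrystallineExtensionData (RD.pst p v hv))
    (hK : letI := (RD.pst p v hv).algebra; FiniteDimensional ℚ_[p] (v.adicCompletion F))
    (ρ : FramedGaloisRep (v.adicCompletion F) (PadicAlgCl p) 2)
    (hρ : (RD.pst p v hv).IsCrystallineFramed ρ) (hred : ¬ FramedRep.IsIrreducible ρ) :
    letI := (RD.pst p v hv).algebra
    IsPotentiallyDiagonalizable 𝔈.𝔅 ρ :=
  𝔈.isPotentiallyDiagonalizable_of_hasInvariantCompleteFlag hK hρ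
    (hasInvariantCompleteFlag_of_not_isIrreducible ρ hred)

/-- The reducible sector of `PD2Unram`, with the finiteness of `F_v/ℚ_p` discharged from the
named fact `FontaineDatumExists` (under it the pinned datum carries the canonical `ℚ_p`-structure
of `F_v`, `fontainePstAdicCompletion_algebra`, for which `F_v/ℚ_p` is finite,
`finiteDimensional_padic_adicCompletion`). [cite: BarnetlambEtAl2014, §1.4 Lemma 1.4.3 (1)] -/
theorem isPotentiallyDiagonalizable_of_not_isIrreducible_of_fontaineDatumExists
    (hF : Literature.NumberTheory.PAdicHodge.FontaineDatumExists)
    (F : Type) [Field F] [NumberField F] (p : ℕ) [Fact p.Prime] (RD : ReciprocityData F)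
    (v : HeightOneSpectrum (𝓞 F)) (hv : ((p : ℕ) : 𝓞 F) ∈ v.asIdeal)
    (𝔈 : PstCrystallineExtensionData (RD.pst p v hv))
    (ρ : FramedGaloisRep (v.adicCompletion F) (PadicAlgCl p) 2)
    (hρ : (RD.pst p v hv).IsCrystallineFramed ρ) (hred : ¬ FramedRep.IsIrreducible ρ) :
    letI := (RD.pst p v hv).algebra
    IsPotentiallyDiagonalizable 𝔈.𝔅 ρ := by
  refine isPotentiallyDiagonalizable_of_not_isIrreducible F p RD v hv 𝔈 ?_ ρ hρ hred
  have halg : (RD.pst p v hv).algebra = LocalField.adicCompletionPadicAlgebra v p hv :=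
    Literature.NumberTheory.PAdicHodge.fontainePstAdicCompletion_algebra hF v p hv
  rw [halg]
  exact Literature.NumberTheory.EllipticCurves.ModularForms.finiteDimensional_padic_adicCompletion
    v p hv

end Summit.Langlands.Langlands.Theorems
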